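import Literature.AlgebraicGeometry.HodgeTheory.BettiKunnethPieceHodgeClassActions
import Literature.AlgebraicGeometry.HodgeTheory.BettiHodgeConjectureCurveTimesVarietyCorrespondenceCriterion
import Literature.AlgebraicGeometry.HodgeTheory.BettiHodgeConjectureRegularSurfaceTimesVarietyCorrespondenceCriterion
import Literature.AlgebraicGeometry.HodgeTheory.BettiHodgeConjectureThreefoldQZeroH20ZeroTimesVarietyCorrespondenceCriterion
import HarnessLib

/-!
# `HC(Y × Z)` for an off-middle algebraic factor `Y` (curve, regular surface, threefold with `q = h^{2,0} = 0`, …) and an `n`-fold `Z` with `HC(Z)` IFF, for every Künneth piece `Hᵐ(Y) ⊗ Hʲ(Z)`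
# (`m = dim Y`, `1 ≤ j ≤ n`, `m + j = 2c`), every morphism of Hodge structures `H^{2n−j}(Z) → Hᵐ(Y)(c − n)` — on carriers: every ℂ-linear map preserving the rational lattices, of bidegree
# `(c − n, c − n)`, killing the types below — is induced by a rational algebraic class of `H^{2c}(Y × Z)`
# (Voisin I §7.3.1 Def. 7.22, §11.3.3 Thm. 11.38–11.40, Lemma 11.41, pp. 285–287; Voisin II (10.7); Voisin 2025 §3.2.1; Deligne 2000 §1)

Family `hodge`, lane `lit-hodgefound` (Track 2 foundations library; Layers A1/A4), layer `Literature/AlgebraicGeometry/HodgeTheory`.  THEOREMS ONLY (no definition, no named fact, no instance;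
D-0026 net debt `0`).  The seat's ∃-form criteria (g30-#3 `…_iff_forall_exists_corrAction_eq_left`; g30-#7 curves, g30-#8 regular surfaces, g30-#10 threefolds with `q = h^{2,0} = 0`) say:
`HC(Y × Z)` iff every HODGE CLASS `t` of each relevant Künneth summand acts on `H^{2n−j}(Z;ℂ)` as some rational algebraic class does.  By Lemma 11.41 on the carriers (g30-#14) the actions of the Hodge
classes of the summand `Hⁱ(Y;ℚ) ⊗ Hʲ(Z;ℚ)` are exactly the TYPE-SHIFTING maps `f : Hᵃ(Z;ℂ) → Hⁱ(Y;ℂ)` (`a = 2n − j`): rational classes to rational classes, type `(p, q)` to type `(p + c − n, q + c − n)`,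
zero on the types with `p + c < n` or `q + c < n` — the carrier form of the morphisms of Hodge structures `Hᵃ(Z) → Hⁱ(Y)(c − n)` (Def. 7.22).  §1 converts one into the other for any piece; §2 states
the general off-middle criterion in that language; §3 the three families.

WHAT IS PROVED.
* §1 **`BettiUniverse.forall_hodgeClasses_exists_algebraic_corrAction_eq_iff_forall_typeShift`** (for one piece: «every Hodge class of the summand acts as an algebraic class» ⟺ «every type-shifting map
  is the action of an algebraic class»).
* §2 **`BettiUniverse.hodgeConjectureFor_tensor_iff_forall_typeShift_exists_algebraic_left`** (`Y` off-middle algebraic with `HC(Y)`, `Z` with `HC(Z)`).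
* §3 **`BettiUniverse.hodgeConjectureFor_curve_tensor_iff_forall_typeShift_exists_algebraic`** (pieces `H¹C ⊗ HʲZ`, `j` odd, `3 ≤ j ≤ n`), **`BettiUniverse.hodgeConjectureFor_regularSurface_tensor_iff_forall_typeShift_exists_algebraic`**
  (`H²S ⊗ HʲZ`, `j` even, `2 ≤ j ≤ n`), **`BettiUniverse.hodgeConjectureFor_threefold_tensor_iff_forall_typeShift_exists_algebraic_of_q_zero_of_h20_zero`** (`H³T ⊗ HʲZ`, `j` odd, `j ≤ n`).

THE PRINTS.  C. Voisin (2002) [VoisinHodgeI2002] §7.3.1 Def. 7.22; §11.3.3 Thm. 11.38–11.40, Lemma 11.41 and pp. 285–287.  C. Voisin (2003) [VoisinHodgeII2003] §10.2.2 proof of Thm. 10.17, (10.7).  C. Voisin (2025) [Voisin2025]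
§3.2.1 (12)–(14), Prop. 3.8, Cor. 3.9.  P. Deligne (2000/2006) [Deligne2000] §1.

THE OBJECTS (all the tree's).  `corrAction complexOrientationFamily hY hZ hab`, `BettiUniverse.crossMap`, `BettiUniverse.kunnethSummand`, `hodgeClasses`, `hodgeNumber`, `IsOfHodgeType`, `IsRationalClass`, `ofRatClass`,
`algebraicClasses`, `HodgeConjectureFor`; the seat's g30-#14 `…exists_mem_hodgeClasses_corrAction_crossMap_eq_of_typeShift`, `…typeShift_corrAction_crossMap_of_mem_hodgeClasses`, g30-#3/#7/#8/#10 ∃-form criteria.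

DEVIATIONS / SCOPE.  Complex orientations; carriers only.  No definitions.

## References
* [VoisinHodgeI2002] C. Voisin, *Hodge Theory and Complex Algebraic Geometry I* (2002) — §7.3.1 Def. 7.22; §11.3.3 Thm. 11.38–11.40, Lemma 11.41, pp. 285–287.
* [VoisinHodgeII2003] C. Voisin, *Hodge Theory and Complex Algebraic Geometry II* (2003) — §10.2.2 proof of Thm. 10.17 (10.7).
* [Voisin2025] C. Voisin, *Cycle classes on algebraic varieties* (2025) — §3.2.1 (12)–(14), Prop. 3.8, Cor. 3.9.
* [Deligne2000] P. Deligne, *The Hodge conjecture* (Clay problem description) — §1.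

## Provenance
Lane `lit-hodgefound` (Hodge path, Track 2), prover seat `lit-hodgefound-p29` (generation 30), self-proposed row g30-#16 (off-middle ∃-form criteria read through Lemma 11.41 on carriers).
-/

noncomputable section

open scoped TensorProduct
open CategoryTheory MonoidalCategory CartesianMonoidalCategory Module Finset
open Literature.AlgebraicTopology.SingularHomology
open Literature.Geometry.Kaehler

namespace Literature.AlgebraicGeometry.HodgeTheory

open Literature.AlgebraicGeometry.Motives
open Literature.AlgebraicGeometry.Motives.HodgeStructure

variable {m n d : ℕ} {Y Z C S T : SchemeOver ℂ}

variable [HodgeTensorFacts.{0, 0}]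

/-! ### §1 Hodge classes of the summand versus type-shifting maps, under «acts as an algebraic class» -/

/-- **For one Künneth piece `Hⁱ(Y) ⊗ Hʲ(Z) ⊂ H^{2c}(Y × Z)` (`a + j = 2 dim Z`): every Hodge class of the summand acts on `Hᵃ(Z;ℂ)` as some rational algebraic class of `H^{2c}(Y × Z)` does IFF every type-shifting
`f : Hᵃ(Z;ℂ) → Hⁱ(Y;ℂ)` (rational lattices, bidegree `(c − n, c − n)`, zero below) is the action of some rational algebraic class** (Lemma 11.41 on carriers, the seat's g30-#14; complex orientations).
[cite: VoisinHodgeI2002, §7.3.1 Def. 7.22, §11.3.3 Lemma 11.41 and pp. 285–287] [cite: Voisin2025, §3.2.1 (12)–(14), Prop. 3.8 and Cor. 3.9] -/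
theorem BettiUniverse.forall_hodgeClasses_exists_algebraic_corrAction_eq_iff_forall_typeShift (hHD : exists_isReal_hodgeModel) (hY : IsSmoothProjective m Y) (hZ : IsSmoothProjective n Z) {c i j a : ℕ}
    (hij : i + j = 2 * c) (haj : a + j = 2 * n) (hab : a + 2 * c = i + 2 * n) :
    (∀ t ∈ (BettiUniverse.kunnethSummand hHD hY hZ (2 * c) ⟨(i, j), mem_antidiagonal.2 hij⟩).hodgeClasses c,
        ∃ γ : bettiCohomology (Y ⊗ Z) (2 * c), ofRatClass (ComplexPoints (Y ⊗ Z)) (2 * c) γ ∈ algebraicClasses (Y ⊗ Z) c ∧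
          corrAction complexOrientationFamily hY hZ hab (ofRatClass (ComplexPoints (Y ⊗ Z)) (2 * c) γ) =
            corrAction complexOrientationFamily hY hZ hab (ofRatClass (ComplexPoints (Y ⊗ Z)) (2 * c) (BettiUniverse.crossMap Y Z hij t))) ↔
      ∀ f : complexBetti Z a →ₗ[ℂ] complexBetti Y i, (∀ u, IsRationalClass u → IsRationalClass (f u)) → (∀ (p q : ℕ), p + q = a → ∀ u : complexBetti Z a, IsOfHodgeType n Z a p q u → ∀ p' q' : ℕ, p' + n = p + c → q' + n = q + c → IsOfHodgeType m Y i p' q' (f u)) → (∀ (p q : ℕ), p + q = a → ∀ u : complexBetti Z a, IsOfHodgeType n Z a p q u → p + c < n ∨ q + c < n → f u = 0) →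
        ∃ γ : bettiCohomology (Y ⊗ Z) (2 * c), ofRatClass (ComplexPoints (Y ⊗ Z)) (2 * c) γ ∈ algebraicClasses (Y ⊗ Z) c ∧
          corrAction complexOrientationFamily hY hZ hab (ofRatClass (ComplexPoints (Y ⊗ Z)) (2 * c) γ) = f := by
  constructor
  · intro h f hR hS hV
    obtain ⟨t, ht, htf⟩ := BettiUniverse.exists_mem_hodgeClasses_corrAction_crossMap_eq_of_typeShift hHD hY hZ hij haj hab f hR hS hV
    obtain ⟨γ, hγ, hact⟩ := h t ht
    exact ⟨γ, hγ, hact.trans htf⟩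
  · intro h t ht
    obtain ⟨hR, hS, hV⟩ := BettiUniverse.typeShift_corrAction_crossMap_of_mem_hodgeClasses hHD hY hZ hij hab ht
    exact h _ hR (fun p q _ u hu p' q' hp hq ↦ hS p q u hu p' q' hp hq) (fun p q _ u hu hlt ↦ hV p q u hu hlt)

/-! ### §2 The off-middle criterion in the language of morphisms of Hodge structures -/

/-- **`HC(Y × Z)` for `Y` off-middle algebraic (`b_k(Y) = 0` for odd `k ≠ m = dim Y`, `Hdgᵖ(H^{2p}Y) = ⊤` for `2p ≠ m`) with `HC(Y)` and an `n`-fold `Z` with `HC(Z)` IFF for every `j` with `1 ≤ j ≤ n`,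
`m + j = 2c`, every type-shifting `f : H^{2n−j}(Z;ℂ) → Hᵐ(Y;ℂ)` — every morphism of Hodge structures `H^{2n−j}(Z) → Hᵐ(Y)(c − n)` on carriers — is the action of a rational algebraic class of
`H^{2c}(Y × Z)`** (complex orientations). [cite: VoisinHodgeI2002, §7.3.1 Def. 7.22, §11.3.3 Thm. 11.38–11.40, Lemma 11.41 and pp. 285–287] [cite: Voisin2025, §3.2.1 (12)–(14), Prop. 3.8 and Cor. 3.9] [cite: Deligne2000, §1] -/
theorem BettiUniverse.hodgeConjectureFor_tensor_iff_forall_typeShift_exists_algebraic_left (hHD : exists_isReal_hodgeModel) (hY : IsSmoothProjective m Y) (hZ : IsSmoothProjective n Z)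
    (hYZ : IsSmoothProjective d (Y ⊗ Z)) (hHCY : HodgeConjectureFor m Y) (hHCZ : HodgeConjectureFor n Z) (hodd : ∀ k, Odd k → k ≠ m → Module.finrank ℚ (bettiCohomology Y k) = 0)
    (heven : ∀ p, 2 * p ≠ m → (BettiUniverse.hodge hHD hY (2 * p)).hodgeClasses p = ⊤) :
    HodgeConjectureFor d (Y ⊗ Z) ↔
      ∀ (c j a : ℕ) (_hmj : m + j = 2 * c) (hab : a + 2 * c = m + 2 * n), 1 ≤ j → j ≤ n →
        ∀ f : complexBetti Z a →ₗ[ℂ] complexBetti Y m, (∀ u, IsRationalClass u → IsRationalClass (f u)) → (∀ (p q : ℕ), p + q = a → ∀ u : complexBetti Z a, IsOfHodgeType n Z a p q u → ∀ p' q' : ℕ, p' + n = p + c → q' + n = q + c → IsOfHodgeType m Y m p' q' (f u)) → (∀ (p q : ℕ), p + q = a → ∀ u : complexBetti Z a, IsOfHodgeType n Z a p q u → p + c < n ∨ q + c < n → f u = 0) →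
          ∃ γ : bettiCohomology (Y ⊗ Z) (2 * c), ofRatClass (ComplexPoints (Y ⊗ Z)) (2 * c) γ ∈ algebraicClasses (Y ⊗ Z) c ∧
            corrAction complexOrientationFamily hY hZ hab (ofRatClass (ComplexPoints (Y ⊗ Z)) (2 * c) γ) = f := by
  rw [BettiUniverse.hodgeConjectureFor_tensor_iff_forall_exists_corrAction_eq_left complexOrientationFamily hHD hY hZ hYZ hHCY hHCZ hodd heven]
  refine forall_congr' fun c ↦ forall_congr' fun j ↦ forall_congr' fun a ↦ forall_congr' fun hmj ↦ forall_congr' fun hab ↦ forall_congr' fun _ ↦ forall_congr' fun _ ↦ ?_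
  exact BettiUniverse.forall_hodgeClasses_exists_algebraic_corrAction_eq_iff_forall_typeShift hHD hY hZ hmj (by omega) hab

/-! ### §3 Curves, regular surfaces, threefolds with `q = h^{2,0} = 0` -/

/-- **`HC(C × Z)` (`C` a curve, `Z` an `n`-fold with `HC(Z)`) IFF for every odd `j` with `3 ≤ j ≤ n` (`1 + j = 2c`) every type-shifting `f : H^{2n−j}(Z;ℂ) → H¹(C;ℂ)` — every morphism of Hodge structures
`H^{2n−j}(Z) → H¹(C)(c − n)` on carriers — is the action of a rational algebraic class of `H^{2c}(C × Z)`.** [cite: VoisinHodgeI2002, §7.3.1 Def. 7.22, §11.3.3 Lemma 11.41 and pp. 285–287, §12.1]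
[cite: Voisin2025, §3.2.1 (12)–(14), Prop. 3.8 and Cor. 3.9] [cite: Deligne2000, §1] -/
theorem BettiUniverse.hodgeConjectureFor_curve_tensor_iff_forall_typeShift_exists_algebraic (hHD : exists_isReal_hodgeModel) (hC : IsSmoothProjective 1 C) (hZ : IsSmoothProjective n Z)
    (hCZ : IsSmoothProjective d (C ⊗ Z)) (hHCZ : HodgeConjectureFor n Z) :
    HodgeConjectureFor d (C ⊗ Z) ↔
      ∀ (c j a : ℕ) (_hj : 1 + j = 2 * c) (hab : a + 2 * c = 1 + 2 * n), 3 ≤ j → j ≤ n →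
        ∀ f : complexBetti Z a →ₗ[ℂ] complexBetti C 1, (∀ u, IsRationalClass u → IsRationalClass (f u)) → (∀ (p q : ℕ), p + q = a → ∀ u : complexBetti Z a, IsOfHodgeType n Z a p q u → ∀ p' q' : ℕ, p' + n = p + c → q' + n = q + c → IsOfHodgeType 1 C 1 p' q' (f u)) → (∀ (p q : ℕ), p + q = a → ∀ u : complexBetti Z a, IsOfHodgeType n Z a p q u → p + c < n ∨ q + c < n → f u = 0) →
          ∃ γ : bettiCohomology (C ⊗ Z) (2 * c), ofRatClass (ComplexPoints (C ⊗ Z)) (2 * c) γ ∈ algebraicClasses (C ⊗ Z) c ∧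
            corrAction complexOrientationFamily hC hZ hab (ofRatClass (ComplexPoints (C ⊗ Z)) (2 * c) γ) = f := by
  rw [BettiUniverse.hodgeConjectureFor_curve_tensor_iff_forall_exists_corrAction_eq complexOrientationFamily hHD hC hZ hCZ hHCZ]
  refine forall_congr' fun c ↦ forall_congr' fun j ↦ forall_congr' fun a ↦ forall_congr' fun hj ↦ forall_congr' fun hab ↦ forall_congr' fun _ ↦ forall_congr' fun _ ↦ ?_
  exact BettiUniverse.forall_hodgeClasses_exists_algebraic_corrAction_eq_iff_forall_typeShift hHD hC hZ hj (by omega) hab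

/-- **`HC(S × Z)` (`S` a regular surface, `Z` an `n`-fold with `HC(Z)`) IFF for every even `j` with `2 ≤ j ≤ n` (`2 + j = 2c`) every type-shifting `f : H^{2n−j}(Z;ℂ) → H²(S;ℂ)` — every morphism of Hodge
structures `H^{2n−j}(Z) → H²(S)(c − n)` on carriers — is the action of a rational algebraic class of `H^{2c}(S × Z)`.** [cite: VoisinHodgeI2002, §7.3.1 Def. 7.22, §11.3.3 Lemma 11.41 and pp. 285–287]
[cite: Voisin2025, §3.2.1 (12)–(14), Prop. 3.8 and Cor. 3.9] [cite: Deligne2000, §1] -/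
theorem BettiUniverse.hodgeConjectureFor_regularSurface_tensor_iff_forall_typeShift_exists_algebraic (hHD : exists_isReal_hodgeModel) (hS : IsSmoothProjective 2 S) (hZ : IsSmoothProjective n Z)
    (hSZ : IsSmoothProjective d (S ⊗ Z)) (hHCZ : HodgeConjectureFor n Z) (h10 : (BettiUniverse.hodge hHD hS 1).hodgeNumber 1 0 = 0) :
    HodgeConjectureFor d (S ⊗ Z) ↔
      ∀ (c j a : ℕ) (_hj : 2 + j = 2 * c) (hab : a + 2 * c = 2 + 2 * n), 2 ≤ j → j ≤ n →
        ∀ f : complexBetti Z a →ₗ[ℂ] complexBetti S 2, (∀ u, IsRationalClass u → IsRationalClass (f u)) → (∀ (p q : ℕ), p + q = a → ∀ u : complexBetti Z a, IsOfHodgeType n Z a p q u → ∀ p' q' : ℕ, p' + n = p + c → q' + n = q + c → IsOfHodgeType 2 S 2 p' q' (f u)) → (∀ (p q : ℕ), p + q = a → ∀ u : complexBetti Z a, IsOfHodgeType n Z a p q u → p + c < n ∨ q + c < n → f u = 0) →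
          ∃ γ : bettiCohomology (S ⊗ Z) (2 * c), ofRatClass (ComplexPoints (S ⊗ Z)) (2 * c) γ ∈ algebraicClasses (S ⊗ Z) c ∧
            corrAction complexOrientationFamily hS hZ hab (ofRatClass (ComplexPoints (S ⊗ Z)) (2 * c) γ) = f := by
  rw [BettiUniverse.hodgeConjectureFor_regularSurface_tensor_iff_forall_exists_corrAction_eq complexOrientationFamily hHD hS hZ hSZ hHCZ h10]
  refine forall_congr' fun c ↦ forall_congr' fun j ↦ forall_congr' fun a ↦ forall_congr' fun hj ↦ forall_congr' fun hab ↦ forall_congr' fun _ ↦ forall_congr' fun _ ↦ ?_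
  exact BettiUniverse.forall_hodgeClasses_exists_algebraic_corrAction_eq_iff_forall_typeShift hHD hS hZ hj (by omega) hab

/-- **`HC(T × Z)` (`T` a threefold with `q = h^{2,0} = 0`, `Z` an `n`-fold with `HC(Z)`) IFF for every odd `j` with `1 ≤ j ≤ n` (`3 + j = 2c`) every type-shifting `f : H^{2n−j}(Z;ℂ) → H³(T;ℂ)` — every
morphism of Hodge structures `H^{2n−j}(Z) → H³(T)(c − n)` on carriers — is the action of a rational algebraic class of `H^{2c}(T × Z)`.** [cite: VoisinHodgeI2002, §7.3.1 Def. 7.22, §11.3.3 Lemma 11.41 and pp. 285–287]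
[cite: Voisin2025, §3.2.1 (12)–(14), Prop. 3.8 and Cor. 3.9] [cite: Deligne2000, §1] -/
theorem BettiUniverse.hodgeConjectureFor_threefold_tensor_iff_forall_typeShift_exists_algebraic_of_q_zero_of_h20_zero (hHD : exists_isReal_hodgeModel) (hT : IsSmoothProjective 3 T)
    (hZ : IsSmoothProjective n Z) (hTZ : IsSmoothProjective d (T ⊗ Z)) (hHCZ : HodgeConjectureFor n Z) (h10 : (BettiUniverse.hodge hHD hT 1).hodgeNumber 1 0 = 0)
    (h20 : (BettiUniverse.hodge hHD hT 2).hodgeNumber 2 0 = 0) :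
    HodgeConjectureFor d (T ⊗ Z) ↔
      ∀ (c j a : ℕ) (_hj : 3 + j = 2 * c) (hab : a + 2 * c = 3 + 2 * n), 1 ≤ j → j ≤ n →
        ∀ f : complexBetti Z a →ₗ[ℂ] complexBetti T 3, (∀ u, IsRationalClass u → IsRationalClass (f u)) → (∀ (p q : ℕ), p + q = a → ∀ u : complexBetti Z a, IsOfHodgeType n Z a p q u → ∀ p' q' : ℕ, p' + n = p + c → q' + n = q + c → IsOfHodgeType 3 T 3 p' q' (f u)) → (∀ (p q : ℕ), p + q = a → ∀ u : complexBetti Z a, IsOfHodgeType n Z a p q u → p + c < n ∨ q + c < n → f u = 0) →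
          ∃ γ : bettiCohomology (T ⊗ Z) (2 * c), ofRatClass (ComplexPoints (T ⊗ Z)) (2 * c) γ ∈ algebraicClasses (T ⊗ Z) c ∧
            corrAction complexOrientationFamily hT hZ hab (ofRatClass (ComplexPoints (T ⊗ Z)) (2 * c) γ) = f := by
  rw [BettiUniverse.hodgeConjectureFor_threefold_tensor_iff_forall_exists_corrAction_eq_of_q_zero_of_h20_zero complexOrientationFamily hHD hT hZ hTZ hHCZ h10 h20]
  refine forall_congr' fun c ↦ forall_congr' fun j ↦ forall_congr' fun a ↦ forall_congr' fun hj ↦ forall_congr' fun hab ↦ forall_congr' fun _ ↦ forall_congr' fun _ ↦ ?_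
  exact BettiUniverse.forall_hodgeClasses_exists_algebraic_corrAction_eq_iff_forall_typeShift hHD hT hZ hj (by omega) hab

end Literature.AlgebraicGeometry.HodgeTheory

end
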